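import Literature.NumberTheory.EllipticCurves.BSDConductorIsEllipticLeafProofs
import Literature.NumberTheory.EllipticCurves.OggFormulaWildThreeProofs
import HarnessLib

/-!
# bsd.S15 (d), corrected ideal form `𝔣(E/ℚ) = 𝔣^{(ℓ)}(V_ℓ E) · (ℓ)^{f_ℓ}`, after Ogg's `p = 3` theorem:
# unconditionally at `ℓ = 2`, unconditionally for curves not additive at `2`, and from Saito's
# `p = 2` theorem alone for every `ℓ`

`Proofs` file (theorems only, no definitions, no named facts) in topic
`NumberTheory/EllipticCurves`, landed by the tenured seat of the bsd.S15 fact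
`Literature.NumberTheory.EllipticCurves.conductor_eq_conductorOf_mul_of_isElliptic W ℓ`
(`BSDConductor`): *for an elliptic curve `E/ℚ` given by `W` and every prime `ℓ`, the conductor
ideal `𝔣(E/ℚ) = ∏_v v^{f_v}` of `𝓞 ℚ` (item G22, `f_v` defined by Ogg's formula
`ord_v Δ_min + 1 - m_v`) is the prime-to-`ℓ` Artin conductor `𝔣^{(ℓ)}(V_ℓ E) = ∏_{v ∤ ℓ} v^{a_v(V_ℓ E)}`
(item C15) times `v_ℓ^{f_ℓ}`* — Silverman, *Advanced Topics in the Arithmetic of Elliptic Curves*,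
§IV.10: Definition of `ε, δ, f = ε + δ` and Thm. 10.2 (PDF p. 358 of the held copy), Definition of
`𝔣(E/K)` (p. 364); §IV.11, Ogg's formula 11.1 (p. 365) and its proof (pp. 366–371).

`BSDConductorIsEllipticLeafProofs` reduced the fact to the single leaf hW23 (Ogg's formula for the
wild part of the conductor at the additive places of residue characteristic `2, 3`), i.e. to its
two halves `…_of_ringChar_eq_two W ℓ` (Saito 1988, Thm. 1 — *ATAEC* p. 366: *"for this last case
we refer the reader to Saito's proof"*) and `…_of_ringChar_eq_three W ℓ` (Ogg 1967; the case
proved in *ATAEC*, pp. 366–371), and proved the instance `ℓ = 2` from the `p = 3` half alone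
(`conductor_eq_conductorOf_mul_of_isElliptic_two_of_three`: the place `2` is the exempted place
`v_ℓ`).  The `p = 3` half is now a **theorem** of the tree,
`WeierstrassCurve.swanConductorAt_rationalTate_eq_wildConductorExponent_of_ringChar_eq_three_holds`
(`OggFormulaWildThreeProofs`: Silverman's case-by-case proof of 11.1 for `p = 3` with `ℓ = 2` —
Tate's normal forms, the Eisenstein `2`-division cubic, the ramification of its splitting field in
residue characteristic `3` — transported to every `ℓ` by the `ℓ`-independence of the wild conductor
at the places not above `2`).  Feeding it in gives:

* `conductor_eq_conductorOf_mul_of_isElliptic_two` — **the fact at `ℓ = 2` for every `W / ℚ`, no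
  hypothesis left**: for elliptic `W` and every continuity proof `h`,
  `𝔣(E/ℚ) = 𝔣^{(2)}(V₂ E) · v₂^{f₂}`.  This is exactly the content of *ATAEC* §IV.10–11 as
  printed and proved there (Definition of the conductor p. 364, Thm. 10.2(a),(b) p. 358, Ogg's
  formula 11.1 for `p ≥ 3`, pp. 365–371, with `L = ℚ(E[2])`); neither Saito's theorem nor the
  unproved `ℓ`-independence Thm. IV.10.2(c) at `p = 2` enters.
* `conductor_eq_conductorOf_mul_of_isElliptic_of_not_hasAdditiveReductionAt_two` — **the fact for
  every prime `ℓ` and every `W / ℚ` with good or multiplicative reduction at `2`, no hypothesis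
  left** (Saito's half is vacuous for such a curve).
* `conductor_eq_conductorOf_mul_of_isElliptic_of_two` — for every `W / ℚ` and every prime `ℓ` the
  fact now follows from **Saito's `p = 2` half alone**; the discharge
  `conductor_eq_conductorOf_mul_of_isElliptic_holds` is this theorem fed with the discharge of
  `WeierstrassCurve.swanConductorAt_rationalTate_eq_wildConductorExponent_of_ringChar_eq_two`
  (Ogg–Saito at the additive place `2` of `ℚ`: `Sw₂(V_ℓ E) = ord₂ Δ_min - 1 - m₂` for odd `ℓ`),
  which is not proved in any held source.

No definitions, no named facts.  All axioms `propext`, `Classical.choice`, `Quot.sound`.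

## References

* J. H. Silverman, *Advanced Topics in the Arithmetic of Elliptic Curves*, GTM 151 (1994), §IV.10
  (Definition and Thm. 10.2, PDF p. 358; Definition of `𝔣(E/K)`, p. 364), §IV.11 (Ogg's formula
  11.1, p. 365, and its proof for `p ≥ 3`, pp. 366–371). [SilvermanATAEC1994]
* A. P. Ogg, *Elliptic curves and wild ramification*, Amer. J. Math. 89 (1967). [OggAJM1967]
* T. Saito, *Conductor, discriminant, and the Noether formula of arithmetic surfaces*, Duke Math.
  J. 57 (1988), Theorem 1 (the case `p = 2`, cited only). [Saito1988]

## Design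

No definitions; one-line assemblies on `BSDConductorIsEllipticLeafProofs` and
`OggFormulaWildThreeProofs`; `noncomputable section`; namespace
`Literature.NumberTheory.EllipticCurves` (that of `BSDConductor`).
-/

noncomputable section

open scoped Classical NumberField
open NumberField IsDedekindDomain Field WeierstrassCurve

namespace Literature.NumberTheory.EllipticCurves

section AnyEll

variable (W : WeierstrassCurve ℚ) (ℓ : ℕ) [Fact ℓ.Prime]

/-- **bsd.S15 (d), corrected ideal form, from Saito's `p = 2` theorem alone.**  For every `W / ℚ`
and every prime `ℓ`, `conductor_eq_conductorOf_mul_of_isElliptic W ℓ`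
(`𝔣(E/ℚ) = 𝔣^{(ℓ)}(V_ℓ E) · v_ℓ^{f_ℓ}` for elliptic `W`) follows from the residue-characteristic-`2`
half `swanConductorAt_rationalTate_eq_wildConductorExponent_of_ringChar_eq_two W ℓ` of the leaf
(Ogg–Saito at the additive place `2`; Saito 1988, Thm. 1, cited on *ATAEC* p. 366), the
residue-characteristic-`3` half being the theorem
`swanConductorAt_rationalTate_eq_wildConductorExponent_of_ringChar_eq_three_holds`
(`OggFormulaWildThreeProofs`, *ATAEC* pp. 366–371).  The discharge
`conductor_eq_conductorOf_mul_of_isElliptic_holds` is this theorem fed with the discharge of that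
half.
[cite: SilvermanATAEC1994, §IV.10 Definition of the conductor (PDF p. 364) with Thm. IV.10.2 and Thm. IV.11.1 (pp. 358–371)] -/
theorem conductor_eq_conductorOf_mul_of_isElliptic_of_two
    (h2 : W.swanConductorAt_rationalTate_eq_wildConductorExponent_of_ringChar_eq_two ℓ) :
    conductor_eq_conductorOf_mul_of_isElliptic W ℓ :=
  conductor_eq_conductorOf_mul_of_isElliptic_of_two_of_three W ℓ h2
    (W.swanConductorAt_rationalTate_eq_wildConductorExponent_of_ringChar_eq_three_holds ℓ)

/-- **bsd.S15 (d), corrected ideal form, for every `W / ℚ` with good or multiplicative reduction at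
`2` — no hypothesis left.**  If `W` does not have additive reduction at the place `v₂` of `𝓞 ℚ`
above `2` (`Rat.HeightOneSpectrum.primesEquiv`; its reduction elsewhere, in particular at `3`, being
arbitrary), then for every prime `ℓ`, for elliptic `W` and every continuity proof `h`,
`𝔣(E/ℚ) = 𝔣^{(ℓ)}(V_ℓ E) · v_ℓ^{f_ℓ}`: Silverman *ATAEC* §IV.10, Definition of the conductor
(PDF p. 364), with Thm. IV.10.2(a),(b) (p. 358) and Ogg's formula IV.11.1 for `p ≥ 3`
(pp. 365–371), all theorems of the tree; Saito's `p = 2` theorem is not needed for such a curve.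
From `conductor_eq_conductorOf_mul_of_isElliptic_of_three_of_not_hasAdditiveReductionAt_two`
(`BSDConductorIsEllipticLeafProofs`) fed with
`swanConductorAt_rationalTate_eq_wildConductorExponent_of_ringChar_eq_three_holds`.
[cite: SilvermanATAEC1994, §IV.10 Definition of the conductor (PDF p. 364) with Thm. IV.10.2(a),(b) and Thm. IV.11.1 for p ≥ 3 (pp. 358–371)] -/
theorem conductor_eq_conductorOf_mul_of_isElliptic_of_not_hasAdditiveReductionAt_two
    (h2 : ¬ W.HasAdditiveReductionAt
      ((Rat.HeightOneSpectrum.primesEquiv (R := 𝓞 ℚ)).symm ⟨2, Nat.prime_two⟩)) :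
    conductor_eq_conductorOf_mul_of_isElliptic W ℓ :=
  conductor_eq_conductorOf_mul_of_isElliptic_of_three_of_not_hasAdditiveReductionAt_two W ℓ
    (W.swanConductorAt_rationalTate_eq_wildConductorExponent_of_ringChar_eq_three_holds ℓ) h2

/-- Place-predicate form of
`conductor_eq_conductorOf_mul_of_isElliptic_of_not_hasAdditiveReductionAt_two`: the fact for every
prime `ℓ` and every `W / ℚ` none of whose places of residue characteristic `2` is additive.
[cite: SilvermanATAEC1994, §IV.10 Definition of the conductor (PDF p. 364) with Thm. IV.10.2(a),(b) and Thm. IV.11.1 for p ≥ 3 (pp. 358–371)] -/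
theorem conductor_eq_conductorOf_mul_of_isElliptic_of_forall_not_hasAdditiveReductionAt_two
    (hna2 : ∀ v : HeightOneSpectrum (𝓞 ℚ), ringChar (𝓞 ℚ ⧸ v.asIdeal) = 2 →
      ¬ W.HasAdditiveReductionAt v) :
    conductor_eq_conductorOf_mul_of_isElliptic W ℓ :=
  conductor_eq_conductorOf_mul_of_isElliptic_of_three_of_forall_not_hasAdditiveReductionAt_two W ℓ
    (W.swanConductorAt_rationalTate_eq_wildConductorExponent_of_ringChar_eq_three_holds ℓ) hna2

end AnyEll

section Two

variable (W : WeierstrassCurve ℚ)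

/-- **bsd.S15 (d), corrected ideal form, at `ℓ = 2`, for every `W / ℚ` — no hypothesis left.**
For elliptic `W` and every continuity proof `h` of the `2`-adic representation,

  `𝔣(E/ℚ) = 𝔣^{(2)}(V₂ E) · v₂^{f₂}`,

i.e. `f_v = a_v(V₂ E)` at every place `v ≠ v₂` of `ℚ`, with `f_v = ord_v Δ_min + 1 - m_v` (Ogg's
formula, the tree's definition of the exponent of the conductor) and `a_v` the Artin conductor
exponent `ε_v + δ_v` of `V₂ E` (Silverman *ATAEC* §IV.10, Definition p. 358 with `ℓ = 2`).  This is
the instance `conductor_eq_conductorOf_mul_of_isElliptic_two_of_three`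
(`BSDConductorIsEllipticLeafProofs`; the place `2`, where Saito's theorem would be needed, is the
exempted place `v_ℓ`) fed with Ogg's `p = 3` theorem
`swanConductorAt_rationalTate_eq_wildConductorExponent_of_ringChar_eq_three_holds 2`
(`OggFormulaWildThreeProofs`) — exactly what *ATAEC* prints and proves: Thm. IV.10.2(a),(b)
(p. 358) and Ogg's formula 11.1 for `p ≥ 3` (pp. 365–371, *"Let `L = K(E[2])`"*, p. 366).
Neither Saito's `p = 2` theorem nor Thm. IV.10.2(c) at `p = 2` enters.
[cite: SilvermanATAEC1994, §IV.10 Definition of the conductor (PDF p. 364) with Thm. IV.10.2(a),(b) and Thm. IV.11.1 for p ≥ 3, ℓ = 2 (pp. 358–371)] -/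
theorem conductor_eq_conductorOf_mul_of_isElliptic_two :
    conductor_eq_conductorOf_mul_of_isElliptic W 2 :=
  conductor_eq_conductorOf_mul_of_isElliptic_two_of_three W
    (W.swanConductorAt_rationalTate_eq_wildConductorExponent_of_ringChar_eq_three_holds 2)

/-- **bsd.S15 (d) at `ℓ = 2`, unfolded**: for an elliptic `W / ℚ` and every continuity proof `h`,
`W.conductor (𝓞 ℚ) = conductorOf (geomPoints W) 2 h * v₂ ^ f₂` as an identity of ideals of `𝓞 ℚ`
(the body of `conductor_eq_conductorOf_mul_of_isElliptic W 2`, stated with the instance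
`[W.IsElliptic]` and `h` as hypotheses for direct use).
[cite: SilvermanATAEC1994, §IV.10 Definition of the conductor (PDF p. 364) with Thm. IV.10.2(a),(b) and Thm. IV.11.1 for p ≥ 3, ℓ = 2 (pp. 358–371)] -/
theorem conductor_eq_conductorOf_two_mul [W.IsElliptic]
    (h : Continuous fun x : absoluteGaloisGroup ℚ × RationalTateModule (geomPoints W) 2 ↦
      rationalTateRepresentation (absoluteGaloisGroup ℚ) (geomPoints W) 2 x.1 x.2) :
    W.conductor (𝓞 ℚ) =
      conductorOf (geomPoints W) 2 h *
        ((Rat.HeightOneSpectrum.primesEquiv (R := 𝓞 ℚ)).symm ⟨2, Nat.prime_two⟩).asIdeal ^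
          W.conductorExponent
            ((Rat.HeightOneSpectrum.primesEquiv (R := 𝓞 ℚ)).symm ⟨2, Nat.prime_two⟩) :=
  conductor_eq_conductorOf_mul_of_isElliptic_two W h

end Two

end Literature.NumberTheory.EllipticCurves

end
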